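import Literature.LinearAlgebra.BaseChange.EigenvaluesRationalForm
import Mathlib.LinearAlgebra.TensorProduct.Finiteness
import Mathlib.LinearAlgebra.DirectSum.Finsupp
import Mathlib.LinearAlgebra.FreeModule.Basic
import Mathlib.LinearAlgebra.FiniteDimensional.Basic
import Mathlib.RingTheory.Flat.Basic
import HarnessLib

/-!
# Finite support of a tensor, stable under its rational eigen-operators; eigenvalues of a
# rational form of ANY dimension lie in one finite extension

Companion of `EigenvaluesRationalForm.lean` (same topic `LinearAlgebra/BaseChange`), removing its
finite-dimensionality hypothesis. Let `E₀` be a field, `A` a commutative `E₀`-algebra and `V` an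
`E₀`-vector space of ANY dimension.

* `exists_finset_eq_sum_basis_tmul` — along a basis `B` of `A` over `E₀`, every `y ∈ A ⊗_{E₀} V`
  is the finite sum `∑_b B_b ⊗ ⟨B^*_b, y⟩` of its contractions against the coordinate functionals
  (Bourbaki, *Algebra II*, Ch. II §7 no. 7–8, tensor product with a free module).
* `exists_finiteDimensional_support` — every `x ∈ A ⊗_{E₀} V` comes from `A ⊗_{E₀} V₀` for a
  FINITE-DIMENSIONAL subspace `V₀ ≤ V` (spanned by the contractions `⟨f, x⟩`,
  `f ∈ Hom_{E₀}(A, E₀)`) which is STABLE under every `E₀`-linear `T : V → V` having `x` as an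
  eigenvector after base change, `(1 ⊗ T) x = c • x`, the restriction `T|V₀` keeping the
  eigen-relation on the preimage `x₀` of `x` (`A ⊗ V₀ → A ⊗ V` is injective, `A` being flat over
  the field `E₀`). Key identity: `T ⟨f, x⟩ = ⟨f, (1 ⊗ T) x⟩ = ⟨f, c • x⟩ = ⟨f ∘ (c · _), x⟩ ∈ V₀`.
* `exists_intermediateField_forall_eigenvalue_mem` — hence the theorem of
  `EigenvaluesRationalForm` WITHOUT `FiniteDimensional L V`: for a field extension `C/L`, ANY
  `L`-vector space `V`, `L`-linear `T i` and a common eigenvector `x ≠ 0` in `C ⊗_L V`,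
  `(1 ⊗ T i) x = t i • x`, all `t i` lie in ONE intermediate field finite over `L`; and
  `exists_subfield_forall_eigenvalue_mem`, the packaging for `ℚ ⊆ L ⊆ ℂ` (a subfield of `ℂ`
  finite over `ℚ`).

Use: rationality of Hecke eigenvalues from a rational structure on a complex Hecke module with no
finite-dimensionality of the module (e.g. cohomology or homology of arithmetic quotients with
rational coefficients, before any finiteness theorem): consumer
`Literature.NumberTheory.Automorphic.Clozel1990_heckeEigenvalueField` (Clozel 1990, Thm. 3.13,
§3.1/§3.5; Shimura 1971, Thm. 3.48). Theorems only; no definition, no named fact.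

## References

* N. Bourbaki, *Algebra II*, Ch. II §7–§8 (tensor products with free modules; rational structures).
* G. Shimura, *Introduction to the arithmetic theory of automorphic functions* (1971), §3.5.
  [Shimura1971]
-/

noncomputable section

open scoped TensorProduct

namespace Literature.LinearAlgebra.BaseChange

section Contraction

variable {E₀ : Type*} [Field E₀] {A : Type*} [CommRing A] [Algebra E₀ A]
  {V : Type*} [AddCommGroup V] [Module E₀ V]

/-- The **contraction** of `A ⊗[E₀] V` against an `E₀`-linear functional `f` on `A`:
`c ⊗ v ↦ f(c) • v`. [folklore] -/
theorem lid_rTensor_tmul (f : A →ₗ[E₀] E₀) (c : A) (v : V) :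
    TensorProduct.lid E₀ V (f.rTensor V (c ⊗ₜ[E₀] v)) = f c • v := by
  rw [LinearMap.rTensor_tmul, TensorProduct.lid_tmul]

/-- Contraction commutes with base-changed endomorphisms:
`⟨f, (1 ⊗ T) y⟩ = T ⟨f, y⟩`. [folklore] -/
theorem lid_rTensor_baseChange (f : A →ₗ[E₀] E₀) (T : V →ₗ[E₀] V) (y : A ⊗[E₀] V) :
    TensorProduct.lid E₀ V (f.rTensor V (T.baseChange A y)) =
      T (TensorProduct.lid E₀ V (f.rTensor V y)) := by
  induction y using TensorProduct.induction_on with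
  | zero => simp
  | tmul c v => rw [LinearMap.baseChange_tmul, lid_rTensor_tmul, lid_rTensor_tmul, map_smul]
  | add y z hy hz => simp only [map_add, hy, hz]

/-- Contraction against `f` of `c • y` is contraction against `f ∘ (c · _)` of `y`. [folklore] -/
theorem lid_rTensor_smul (f : A →ₗ[E₀] E₀) (c : A) (y : A ⊗[E₀] V) :
    TensorProduct.lid E₀ V (f.rTensor V (c • y)) =
      TensorProduct.lid E₀ V ((f ∘ₗ LinearMap.mulLeft E₀ c).rTensor V y) := by
  induction y using TensorProduct.induction_on with
  | zero => simp
  | tmul c' v =>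
      rw [TensorProduct.smul_tmul', lid_rTensor_tmul, lid_rTensor_tmul, LinearMap.comp_apply,
        LinearMap.mulLeft_apply, smul_eq_mul]
  | add y z hy hz => simp only [smul_add, map_add, hy, hz]

/-- **Finite expansion along a basis of the coefficient ring.** For a basis `B` of `A` over
`E₀`, every `y ∈ A ⊗[E₀] V` is `∑_{b ∈ s} B_b ⊗ ⟨B^*_b, y⟩` for a finite set `s` of indices, the
coefficients being the contractions of `y` against the coordinate functionals `B^*_b`. [folklore] -/
theorem exists_finset_eq_sum_basis_tmul {ι : Type*} (B : Module.Basis ι E₀ A) (y : A ⊗[E₀] V) :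
    ∃ s : Finset ι, y = ∑ b ∈ s, B b ⊗ₜ[E₀] TensorProduct.lid E₀ V ((B.coord b).rTensor V y) := by
  classical
  -- coordinates: `Φ : A ⊗ V ≃ (ι →₀ V)`
  let Φ : A ⊗[E₀] V ≃ₗ[E₀] (ι →₀ V) :=
    TensorProduct.congr B.repr (LinearEquiv.refl E₀ V) ≪≫ₗ TensorProduct.finsuppScalarLeft E₀ V ι
  have hΦ : ∀ (z : A ⊗[E₀] V) (b : ι),
      Φ z b = TensorProduct.lid E₀ V ((B.coord b).rTensor V z) := by
    intro z b
    induction z using TensorProduct.induction_on with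
    | zero => simp
    | tmul c v =>
        rw [lid_rTensor_tmul, LinearEquiv.trans_apply, TensorProduct.congr_tmul,
          LinearEquiv.refl_apply, TensorProduct.finsuppScalarLeft_apply_tmul_apply,
          Module.Basis.coord_apply]
    | add y z hy hz => simp only [map_add, Finsupp.add_apply, hy, hz, map_add]
  have hΦsymm : ∀ (b : ι) (w : V), Φ.symm (Finsupp.single b w) = B b ⊗ₜ[E₀] w := by
    intro b w
    rw [LinearEquiv.symm_trans_apply, TensorProduct.finsuppScalarLeft_symm_apply_single,
      TensorProduct.congr_symm_tmul, LinearEquiv.refl_symm, LinearEquiv.refl_apply,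
      Module.Basis.repr_symm_single_one]
  refine ⟨(Φ y).support, ?_⟩
  conv_lhs => rw [← Φ.symm_apply_apply y, ← Finsupp.sum_single (Φ y), Finsupp.sum, map_sum]
  exact Finset.sum_congr rfl fun b _ => by rw [hΦsymm, hΦ]

end Contraction

section Support

variable {E₀ : Type*} [Field E₀] {A : Type*} [CommRing A] [Algebra E₀ A]
  {V : Type*} [AddCommGroup V] [Module E₀ V]

/-- **Finite support of a tensor, stable under its rational eigen-operators.** Let `E₀` be a
field, `A` a commutative `E₀`-algebra and `V` ANY `E₀`-vector space. Every `x ∈ A ⊗[E₀] V` comes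
from `A ⊗[E₀] V₀` for a FINITE-DIMENSIONAL subspace `V₀ ≤ V` (the span of the contractions
`⟨f, x⟩`, `f ∈ Hom_{E₀}(A, E₀)`) which is stable under every `E₀`-linear `T : V → V` having `x` as
an eigenvector after base change, `(1 ⊗ T) x = c • x` (`c ∈ A`); and the restriction `T|V₀` has
the preimage `x₀` of `x` as eigenvector with the same eigenvalue. (For `T (⟨f, x⟩) = ⟨f, (1 ⊗ T) x⟩
= ⟨f, c • x⟩ = ⟨f ∘ c, x⟩ ∈ V₀`; injectivity of `A ⊗ V₀ → A ⊗ V` by flatness of `A` over the field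
`E₀`.) This removes every finite-dimensionality hypothesis from the linear algebra behind fields
of rationality of eigenvalues (Clozel 1990, §3.1, proof of Thm. 3.13; Shimura 1971, Thm. 3.48).
[folklore] -/
theorem exists_finiteDimensional_support (x : A ⊗[E₀] V) :
    ∃ (V₀ : Submodule E₀ V) (_ : FiniteDimensional E₀ V₀) (x₀ : A ⊗[E₀] V₀),
      (V₀.subtype.baseChange A) x₀ = x ∧
      ∀ (T : V →ₗ[E₀] V) (c : A), T.baseChange A x = c • x →
        ∃ T₀ : V₀ →ₗ[E₀] V₀, V₀.subtype ∘ₗ T₀ = T ∘ₗ V₀.subtype ∧ T₀.baseChange A x₀ = c • x₀ := by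
  classical
  -- the support `V₀` of `x`: contractions of `x` against all `E₀`-linear functionals on `A`
  let ev : Module.Dual E₀ A →ₗ[E₀] V :=
    (TensorProduct.lid E₀ V).toLinearMap ∘ₗ LinearMap.applyₗ x ∘ₗ LinearMap.rTensorHom V
  have hev : ∀ f : Module.Dual E₀ A, ev f = TensorProduct.lid E₀ V (f.rTensor V x) := fun _ => rfl
  let V₀ : Submodule E₀ V := LinearMap.range ev
  have hmem : ∀ f : Module.Dual E₀ A, TensorProduct.lid E₀ V (f.rTensor V x) ∈ V₀ :=
    fun f => ⟨f, hev f⟩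
  -- (a) `V₀` is finite-dimensional: `x = ∑ cᵢ ⊗ vᵢ` and `⟨f, x⟩ = ∑ f(cᵢ) vᵢ`
  obtain ⟨S, hS⟩ := TensorProduct.exists_finset x
  have hle : V₀ ≤ Submodule.span E₀ (S.image Prod.snd : Set V) := by
    rintro _ ⟨f, rfl⟩
    rw [hev, hS, map_sum, map_sum]
    refine Submodule.sum_mem _ fun p hp => ?_
    rw [lid_rTensor_tmul]
    exact Submodule.smul_mem _ _ (Submodule.subset_span (by
      rw [Finset.coe_image]; exact Set.mem_image_of_mem _ hp))
  haveI : FiniteDimensional E₀ (Submodule.span E₀ (S.image Prod.snd : Set V)) :=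
    FiniteDimensional.span_of_finite E₀ (Finset.finite_toSet _)
  haveI hV₀ : FiniteDimensional E₀ V₀ := Submodule.finiteDimensional_of_le hle
  -- (b) `x` comes from `A ⊗ V₀`: expand along a basis of `A` over `E₀`
  let B := Module.Free.chooseBasis E₀ A
  obtain ⟨s, hs⟩ := exists_finset_eq_sum_basis_tmul B x
  let x₀ : A ⊗[E₀] V₀ := ∑ b ∈ s, B b ⊗ₜ[E₀] (⟨_, hmem (B.coord b)⟩ : V₀)
  have hjx : (V₀.subtype.baseChange A) x₀ = x := by
    rw [map_sum]
    conv_rhs => rw [hs]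
    exact Finset.sum_congr rfl fun b _ => by rw [LinearMap.baseChange_tmul, Submodule.subtype_apply]
  have hj : Function.Injective (V₀.subtype.baseChange A) :=
    Module.Flat.lTensor_preserves_injective_linearMap (M := A) V₀.subtype V₀.injective_subtype
  refine ⟨V₀, hV₀, x₀, hjx, fun T c hT => ?_⟩
  -- (c) `T` preserves `V₀`: `T ⟨f, x⟩ = ⟨f, (1 ⊗ T) x⟩ = ⟨f, c • x⟩ = ⟨f ∘ (c · _), x⟩`
  have hT₀ : ∀ w ∈ V₀, T w ∈ V₀ := by
    rintro _ ⟨f, rfl⟩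
    rw [hev, ← lid_rTensor_baseChange f T x, hT, lid_rTensor_smul]
    exact hmem _
  have hcomp : V₀.subtype ∘ₗ T.restrict hT₀ = T ∘ₗ V₀.subtype := LinearMap.ext fun _ => rfl
  refine ⟨T.restrict hT₀, hcomp, hj ?_⟩
  -- (d) the eigen-relation descends along the injection `A ⊗ V₀ → A ⊗ V`
  rw [map_smul, hjx, ← hT, ← hjx]
  change (V₀.subtype.baseChange A ∘ₗ (T.restrict hT₀).baseChange A) x₀ =
    (T.baseChange A ∘ₗ V₀.subtype.baseChange A) x₀
  rw [← LinearMap.baseChange_comp, ← LinearMap.baseChange_comp, hcomp]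

end Support

/-! ### Eigenvalues of a rational form of any dimension -/

section EigenField

variable {L C : Type*} [Field L] [Field C] [Algebra L C]
  {V : Type*} [AddCommGroup V] [Module L V]

/-- **A simultaneous eigenvector of a rational form of ANY dimension has its eigenvalues in one
finite extension.** Let `C/L` be a field extension, `V` an `L`-vector space (no dimension
hypothesis), `T i` (`i ∈ ι`) `L`-linear endomorphisms of `V`, and `x ≠ 0` in `C ⊗_L V` with
`(1 ⊗ T i) x = t i • x` for all `i`. Then one intermediate field `L ⊆ E ⊆ C`, finite over `L`,
contains every `t i`: restrict to the finite-dimensional support of `x`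
(`exists_finiteDimensional_support`) and apply
`exists_intermediateField_of_eigenvector_baseChange`. [cite: Shimura1971, §3.5 (Thm. 3.48, method)] -/
theorem exists_intermediateField_forall_eigenvalue_mem {ι : Type*} (T : ι → Module.End L V)
    (t : ι → C) {x : C ⊗[L] V} (hx : x ≠ 0) (h : ∀ i, (T i).baseChange C x = t i • x) :
    ∃ E : IntermediateField L C, FiniteDimensional L E ∧ ∀ i, t i ∈ E := by
  obtain ⟨V₀, hV₀, x₀, hx₀x, hT⟩ := exists_finiteDimensional_support x
  have hx₀ : x₀ ≠ 0 := by
    rintro rfl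
    exact hx (by rw [← hx₀x, map_zero])
  choose T₀ _ hT₀ using fun i => hT (T i) (t i) (h i)
  exact exists_intermediateField_of_eigenvector_baseChange T₀ t hx₀ hT₀

end EigenField

section Subfields

/-- **Eigenvalues of a form of any dimension over a number field lie in one number field.** With
`L ⊆ ℂ` finite over `ℚ`, `V` ANY `L`-vector space with `L`-linear operators `T i`, and `x ≠ 0` in
`ℂ ⊗_L V` a simultaneous eigenvector, `(1 ⊗ T i) x = t i • x`: all `t i` lie in one subfield of
`ℂ` finite over `ℚ` (`exists_finiteDimensional_support` +
`exists_subfield_of_eigenvector_baseChange`). [cite: Shimura1971, §3.5 (Thm. 3.48, method)] -/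
theorem exists_subfield_forall_eigenvalue_mem (L : IntermediateField ℚ ℂ) [FiniteDimensional ℚ L]
    {V : Type*} [AddCommGroup V] [Module L V] {ι : Type*} (T : ι → Module.End L V) (t : ι → ℂ)
    {x : ℂ ⊗[L] V} (hx : x ≠ 0) (h : ∀ i, (T i).baseChange ℂ x = t i • x) :
    ∃ E : Subfield ℂ, FiniteDimensional ℚ E ∧ ∀ i, t i ∈ E := by
  obtain ⟨V₀, hV₀, x₀, hx₀x, hT⟩ := exists_finiteDimensional_support x
  have hx₀ : x₀ ≠ 0 := by
    rintro rfl
    exact hx (by rw [← hx₀x, map_zero])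
  choose T₀ _ hT₀ using fun i => hT (T i) (t i) (h i)
  exact exists_subfield_of_eigenvector_baseChange L T₀ t hx₀ hT₀

end Subfields

end Literature.LinearAlgebra.BaseChange

end
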